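import Summits.Ventures.YMGap.Thresholds.OneLinkCasimirTwo
import HarnessLib

/-!
# Venture YMGap — the one-link modulus beyond first order, part 10: CUBIC trace words — smoothness, derivative and the
# pointwise gradient bound on `SU(N)`

HONEST FRAMING: venture file of the cell `pub-ymgap` (QuantumFields programme), strong-coupling LATTICE bookkeeping for `SU(N)`
lattice Yang–Mills; nothing about the continuum or the mass gap in the Clay sense.  Pure matrix calculus («F5», part 2a, of the cell
note `HOME/p2/ONE-LINK-HIERARCHY.md` §4 (4.6), term `T_a`): the cubic words `Re tr(Q M₁ Q M₂ Q M₃)` are the leading part of the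
remainder `c₃ = Γ(Re tr(·B), ψ₂)` (`OneLinkFeedback.Gam_potB_reTrQuad`: `w₃(B,Δ,B)`, `w₃(B,B,Δ)`).

WHAT.
* `contDiff_reTrCubic`, `matD_reTrCubic`: `D_A Re tr(QM₁QM₂QM₃) = Re tr(QAM₁QM₂QM₃) + Re tr(QM₁QAM₂QM₃) + Re tr(QM₁QM₂QAM₃)`.
* `abs_matD_reTrCubic_le`: on `SU(N)`, `|D_A Re tr(QM₁QM₂QM₃)(g)| ≤ (‖M₂gM₃gM₁‖_F + ‖M₃gM₁gM₂‖_F + ‖M₁gM₂gM₃‖_F)·‖A‖_F`, and the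
  specialisation `abs_matD_reTrCubic_le_of_opNorm`: if two of the three letters have operator norm `≤ r` and the third has Frobenius
  norm `≤ δ`, the bound is `3 r² δ ‖A‖_F` (so `Γ ≤ 9 r⁴ δ²` by the frame trick, `Gam_reTrCubic_le`).

References: cell note §4 (4.6); Bröcker–tom Dieck GTM 98 II.5.
-/

noncomputable section

open scoped Matrix ComplexConjugate BigOperators RightActions
open Matrix Complex Finset
open Literature.MathematicalPhysics.QuantumFieldTheory
open Literature.MathematicalPhysics.QuantumFieldTheory.SUNBakryEmery

namespace Summit.Ventures.YMGap.OneLinkEigen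

variable {N : ℕ}

section Calc

open scoped Matrix.Norms.Frobenius ContDiff Topology

/-- `Q ↦ Re tr(Q M₁ Q M₂ Q M₃)` is smooth. [folklore] -/
theorem contDiff_reTrCubic (M₁ M₂ M₃ : Matrix (Fin N) (Fin N) ℂ) :
    ContDiff ℝ ∞ fun Q : Matrix (Fin N) (Fin N) ℂ => (Q * M₁ * Q * M₂ * Q * M₃).trace.re := by
  have h : ContDiff ℝ ∞ fun Q : Matrix (Fin N) (Fin N) ℂ => Q * M₁ * Q * M₂ * Q :=
    (((contDiff_id.mul contDiff_const).mul contDiff_id).mul contDiff_const).mul contDiff_id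
  exact (reTrMul M₃).contDiff.comp h

/-- **`D_A Re tr(QM₁QM₂QM₃) = Re tr(QAM₁QM₂QM₃) + Re tr(QM₁QAM₂QM₃) + Re tr(QM₁QM₂QAM₃)`**. [folklore] -/
theorem matD_reTrCubic (A M₁ M₂ M₃ : Matrix (Fin N) (Fin N) ℂ) :
    matD A (fun Q : Matrix (Fin N) (Fin N) ℂ => (Q * M₁ * Q * M₂ * Q * M₃).trace.re) =
      fun Q => (Q * A * M₁ * Q * M₂ * Q * M₃).trace.re + (Q * M₁ * Q * A * M₂ * Q * M₃).trace.re
        + (Q * M₁ * Q * M₂ * Q * A * M₃).trace.re := by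
  funext Q
  have h1 : HasFDerivAt (fun Q : Matrix (Fin N) (Fin N) ℂ => Q * M₁)
      (ContinuousLinearMap.mulLeftRight ℝ (Matrix (Fin N) (Fin N) ℂ) 1 M₁) Q := hasFDerivAt_mul_const M₁ Q
  have h2 : HasFDerivAt (fun Q : Matrix (Fin N) (Fin N) ℂ => Q * M₂)
      (ContinuousLinearMap.mulLeftRight ℝ (Matrix (Fin N) (Fin N) ℂ) 1 M₂) Q := hasFDerivAt_mul_const M₂ Q
  have h3 : HasFDerivAt (fun Q : Matrix (Fin N) (Fin N) ℂ => Q * 1)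
      (ContinuousLinearMap.mulLeftRight ℝ (Matrix (Fin N) (Fin N) ℂ) 1 1) Q := hasFDerivAt_mul_const 1 Q
  have h123 := (h1.mul' h2).mul' h3
  have h4 := ((reTrMul M₃).hasFDerivAt).comp Q h123
  have hf : (fun Q : Matrix (Fin N) (Fin N) ℂ => (Q * M₁ * Q * M₂ * Q * M₃).trace.re) =
      (reTrMul M₃ : Matrix (Fin N) (Fin N) ℂ → ℝ) ∘
        (((fun Q : Matrix (Fin N) (Fin N) ℂ => Q * M₁) * fun Q => Q * M₂) * fun Q => Q * 1) := by
    funext Q; simp [reTrMul_apply, Matrix.mul_assoc]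
  rw [matD_apply, hf, h4.fderiv]
  simp [reTrMul_apply, Matrix.mul_assoc]
  ring

/-- **`|D_A Re tr(QM₁QM₂QM₃)(g)| ≤ (‖M₁gM₂gM₃‖_F + ‖M₂gM₃gM₁‖_F + ‖M₃gM₁gM₂‖_F) ‖A‖_F`** on `SU(N)`. [folklore] -/
theorem abs_matD_reTrCubic_le (A M₁ M₂ M₃ : Matrix (Fin N) (Fin N) ℂ) (g : SUN N) :
    |matD A (fun Q : Matrix (Fin N) (Fin N) ℂ => (Q * M₁ * Q * M₂ * Q * M₃).trace.re) g| ≤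
      (frobNorm (M₁ * (g : Matrix (Fin N) (Fin N) ℂ) * M₂ * (g : Matrix (Fin N) (Fin N) ℂ) * M₃) + frobNorm (M₂ * (g : Matrix (Fin N) (Fin N) ℂ) * M₃ * (g : Matrix (Fin N) (Fin N) ℂ) * M₁) + frobNorm (M₃ * (g : Matrix (Fin N) (Fin N) ℂ) * M₁ * (g : Matrix (Fin N) (Fin N) ℂ) * M₂)) * frobNorm A := by
  have hg := SUN.mem_unitaryGroup g
  set Q : Matrix (Fin N) (Fin N) ℂ := (g : Matrix (Fin N) (Fin N) ℂ) with hQ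
  rw [matD_reTrCubic]
  show |(Q * A * M₁ * Q * M₂ * Q * M₃).trace.re + (Q * M₁ * Q * A * M₂ * Q * M₃).trace.re
      + (Q * M₁ * Q * M₂ * Q * A * M₃).trace.re| ≤ _
  -- each word is `Re tr((Q A) W)` for a rotation `W` of the letters, `‖Q A‖_F = ‖A‖_F`
  have key : ∀ W : Matrix (Fin N) (Fin N) ℂ, |(Q * A * W).trace.re| ≤ frobNorm W * frobNorm A := by
    intro W
    refine (abs_re_trace_mul_le _ _).trans ?_
    rw [frobNorm_unitary_mul hg, mul_comm]
  have e1 : Q * A * M₁ * Q * M₂ * Q * M₃ = Q * A * (M₁ * Q * M₂ * Q * M₃) := by simp only [Matrix.mul_assoc]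
  have e2 : (Q * M₁ * Q * A * M₂ * Q * M₃).trace = (Q * A * (M₂ * Q * M₃ * Q * M₁)).trace := by
    rw [show Q * M₁ * Q * A * M₂ * Q * M₃ = (Q * M₁) * (Q * A * (M₂ * Q * M₃)) by simp only [Matrix.mul_assoc],
      trace_mul_comm]
    simp only [Matrix.mul_assoc]
  have e3 : (Q * M₁ * Q * M₂ * Q * A * M₃).trace = (Q * A * (M₃ * Q * M₁ * Q * M₂)).trace := by
    rw [show Q * M₁ * Q * M₂ * Q * A * M₃ = (Q * M₁ * Q * M₂) * (Q * A * M₃) by simp only [Matrix.mul_assoc],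
      trace_mul_comm]
    simp only [Matrix.mul_assoc]
  rw [e1, e2, e3]
  have h1 := key (M₁ * Q * M₂ * Q * M₃)
  have h2 := key (M₂ * Q * M₃ * Q * M₁)
  have h3 := key (M₃ * Q * M₁ * Q * M₂)
  calc _ ≤ |(Q * A * (M₁ * Q * M₂ * Q * M₃)).trace.re + (Q * A * (M₂ * Q * M₃ * Q * M₁)).trace.re|
        + |(Q * A * (M₃ * Q * M₁ * Q * M₂)).trace.re| := abs_add_le _ _
    _ ≤ (|(Q * A * (M₁ * Q * M₂ * Q * M₃)).trace.re| + |(Q * A * (M₂ * Q * M₃ * Q * M₁)).trace.re|)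
        + |(Q * A * (M₃ * Q * M₁ * Q * M₂)).trace.re| := by gcongr; exact abs_add_le _ _
    _ ≤ _ := by nlinarith

/-- Frobenius norm of a three-letter word with two letters of operator norm `≤ r` (in positions 1 and 3) and the middle one
of Frobenius norm `δ`: `‖M₁ g M₂ g M₃‖_F ≤ ‖M₁‖_op ‖M₂‖_F ‖M₃‖_op`. [folklore] -/
theorem frobNorm_word3_le (M₁ M₂ M₃ : Matrix (Fin N) (Fin N) ℂ) (g : SUN N) :
    frobNorm (M₁ * (g : Matrix (Fin N) (Fin N) ℂ) * M₂ * (g : Matrix (Fin N) (Fin N) ℂ) * M₃) ≤ matrixOpNorm M₁ * frobNorm M₂ * matrixOpNorm M₃ := by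
  have hg := SUN.mem_unitaryGroup g
  calc frobNorm (M₁ * (g : Matrix (Fin N) (Fin N) ℂ) * M₂ * (g : Matrix (Fin N) (Fin N) ℂ) * M₃) ≤ frobNorm (M₁ * (g : Matrix (Fin N) (Fin N) ℂ) * M₂ * (g : Matrix (Fin N) (Fin N) ℂ)) * matrixOpNorm M₃ := frobNorm_mul_le_mul_matrixOpNorm _ _
    _ = frobNorm (M₁ * ((g : Matrix (Fin N) (Fin N) ℂ) * M₂)) * matrixOpNorm M₃ := by
        rw [frobNorm_mul_unitary _ hg, Matrix.mul_assoc]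
    _ ≤ matrixOpNorm M₁ * frobNorm ((g : Matrix (Fin N) (Fin N) ℂ) * M₂) * matrixOpNorm M₃ :=
        mul_le_mul_of_nonneg_right (frobNorm_mul_le_matrixOpNorm_mul _ _) (matrixOpNorm_nonneg _)
    _ = matrixOpNorm M₁ * frobNorm M₂ * matrixOpNorm M₃ := by rw [frobNorm_unitary_mul hg]

/-- The same with the Frobenius letter in first position: `‖M₁ g M₂ g M₃‖_F ≤ ‖M₁‖_F ‖M₂‖_op ‖M₃‖_op`. [folklore] -/
theorem frobNorm_word3_le' (M₁ M₂ M₃ : Matrix (Fin N) (Fin N) ℂ) (g : SUN N) :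
    frobNorm (M₁ * (g : Matrix (Fin N) (Fin N) ℂ) * M₂ * (g : Matrix (Fin N) (Fin N) ℂ) * M₃) ≤ frobNorm M₁ * matrixOpNorm M₂ * matrixOpNorm M₃ := by
  have hg := SUN.mem_unitaryGroup g
  calc frobNorm (M₁ * (g : Matrix (Fin N) (Fin N) ℂ) * M₂ * (g : Matrix (Fin N) (Fin N) ℂ) * M₃) ≤ frobNorm (M₁ * (g : Matrix (Fin N) (Fin N) ℂ) * M₂ * (g : Matrix (Fin N) (Fin N) ℂ)) * matrixOpNorm M₃ := frobNorm_mul_le_mul_matrixOpNorm _ _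
    _ = frobNorm (M₁ * (g : Matrix (Fin N) (Fin N) ℂ) * M₂) * matrixOpNorm M₃ := by rw [frobNorm_mul_unitary _ hg]
    _ ≤ frobNorm (M₁ * (g : Matrix (Fin N) (Fin N) ℂ)) * matrixOpNorm M₂ * matrixOpNorm M₃ :=
        mul_le_mul_of_nonneg_right (frobNorm_mul_le_mul_matrixOpNorm _ _) (matrixOpNorm_nonneg _)
    _ = frobNorm M₁ * matrixOpNorm M₂ * matrixOpNorm M₃ := by rw [frobNorm_mul_unitary _ hg]

/-- The same with the Frobenius letter in last position: `‖M₁ g M₂ g M₃‖_F ≤ ‖M₁‖_op ‖M₂‖_op ‖M₃‖_F`. [folklore] -/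
theorem frobNorm_word3_le'' (M₁ M₂ M₃ : Matrix (Fin N) (Fin N) ℂ) (g : SUN N) :
    frobNorm (M₁ * (g : Matrix (Fin N) (Fin N) ℂ) * M₂ * (g : Matrix (Fin N) (Fin N) ℂ) * M₃) ≤ matrixOpNorm M₁ * matrixOpNorm M₂ * frobNorm M₃ := by
  have hg := SUN.mem_unitaryGroup g
  calc frobNorm (M₁ * (g : Matrix (Fin N) (Fin N) ℂ) * M₂ * (g : Matrix (Fin N) (Fin N) ℂ) * M₃) = frobNorm (M₁ * ((g : Matrix (Fin N) (Fin N) ℂ) * (M₂ * ((g : Matrix (Fin N) (Fin N) ℂ) * M₃)))) := by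
        simp only [Matrix.mul_assoc]
    _ ≤ matrixOpNorm M₁ * frobNorm ((g : Matrix (Fin N) (Fin N) ℂ) * (M₂ * ((g : Matrix (Fin N) (Fin N) ℂ) * M₃))) :=
        frobNorm_mul_le_matrixOpNorm_mul _ _
    _ = matrixOpNorm M₁ * frobNorm (M₂ * ((g : Matrix (Fin N) (Fin N) ℂ) * M₃)) := by rw [frobNorm_unitary_mul hg]
    _ ≤ matrixOpNorm M₁ * (matrixOpNorm M₂ * frobNorm ((g : Matrix (Fin N) (Fin N) ℂ) * M₃)) :=
        mul_le_mul_of_nonneg_left (frobNorm_mul_le_matrixOpNorm_mul _ _) (matrixOpNorm_nonneg _)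
    _ = matrixOpNorm M₁ * matrixOpNorm M₂ * frobNorm M₃ := by rw [frobNorm_unitary_mul hg]; ring

/-- **The two cubic words of the remainder**: for `‖B‖_op = r` and any `Δ`, on `SU(N)`,
`|D_A Re tr(Q B Q Δ Q B)(g)| ≤ 3 r² ‖Δ‖_F ‖A‖_F` and `|D_A Re tr(Q B Q B Q Δ)(g)| ≤ 3 r² ‖Δ‖_F ‖A‖_F`
(the words `w₃(B,Δ,B) = tr(BQΔQBQ) = tr(QΔQBQB)`… are cyclic rotations of these). [folklore] -/
theorem abs_matD_reTrCubic_BDB_le (A B Δ : Matrix (Fin N) (Fin N) ℂ) (g : SUN N) :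
    |matD A (fun Q : Matrix (Fin N) (Fin N) ℂ => (Q * B * Q * Δ * Q * B).trace.re) g| ≤
      3 * matrixOpNorm B ^ 2 * frobNorm Δ * frobNorm A := by
  refine (abs_matD_reTrCubic_le A B Δ B g).trans ?_
  have h1 := frobNorm_word3_le B Δ B g
  have h2 := frobNorm_word3_le' Δ B B g
  have h3 := frobNorm_word3_le'' B B Δ g
  have hA := frobNorm_nonneg A
  nlinarith [mul_le_mul_of_nonneg_right (add_le_add (add_le_add h1 h2) h3) hA]

/-- Second cubic word: `|D_A Re tr(Q B Q B Q Δ)(g)| ≤ 3 r² ‖Δ‖_F ‖A‖_F`. [folklore] -/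
theorem abs_matD_reTrCubic_BBD_le (A B Δ : Matrix (Fin N) (Fin N) ℂ) (g : SUN N) :
    |matD A (fun Q : Matrix (Fin N) (Fin N) ℂ => (Q * B * Q * B * Q * Δ).trace.re) g| ≤
      3 * matrixOpNorm B ^ 2 * frobNorm Δ * frobNorm A := by
  refine (abs_matD_reTrCubic_le A B B Δ g).trans ?_
  have h1 := frobNorm_word3_le'' B B Δ g
  have h2 := frobNorm_word3_le B Δ B g
  have h3 := frobNorm_word3_le' Δ B B g
  have hA := frobNorm_nonneg A
  nlinarith [mul_le_mul_of_nonneg_right (add_le_add (add_le_add h1 h2) h3) hA]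

end Calc

end Summit.Ventures.YMGap.OneLinkEigen
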